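import Literature.NumberTheory.Sieve.SmoothParityAsymptoticRatesTerms
import HarnessLib

/-!
# Decay of the flat major- and minor-arc errors along the polylog regime

Topic `Literature/NumberTheory/Sieve`, namespace `Literature.NumberTheory.Sieve.SmoothArcs`; a PROVED bookkeeping file
([Harper2016, §5]).  The flat errors `F` (`SmoothParityMajorArcsFlat`) and `s` (`SmoothParityMinorArcsFlat`) of the
zeroth-order circle method are bounded, for the parameter choice of `SmoothParityAsymptotic`
(`L = log x`, `R ∈ [L^r/2, L^r]`, `r = 10B + 300`, `Λ = R⁴`, `e_B = L^B`, `η = C_W(B'+1)² log y/L`, `y ≤ L^{100000}`,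
`G₀ = x^{1−10⁻⁴}/(√(6π)L)`, `Φ = 3L²`, `R_b = R/e_B`), by constant multiples of the single decaying gauge
`g(x) = (log L)²/L + L^{−1/6} + L^{N} x^{−1/20}` (`N = 23r + 3B + 200051`):
`major_rate` (`F, Δ, W, η ≤ A·g`) and `minor_rate` (`L^{48} e_B² s ≤ A·g`) with one constant `A ≥ 0` each; the four terms of
`s` (`minor_term_a`, `_b`, `_cd`) are here, the five terms of `F` in `SmoothParityAsymptoticRatesTerms`.  Pure real arithmetic.

## References

* A. J. Harper, Compositio Math. 152 (2016), §5 [Harper2016].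
-/

noncomputable section

open Real

namespace Literature.NumberTheory.Sieve

namespace SmoothArcs

/-! ### The four terms of the flat minor-arc error -/

section Minor

variable {x Rb P C : ℝ} {y : ℕ} {B : ℕ}

/-- `y^{1/4000} ≤ L^{25}` for `1 ≤ y ≤ L^{100000}`, `L ≥ 0`. [folklore] -/
theorem rpow_y_le {L : ℝ} (hL : 0 ≤ L) (hy1 : 1 ≤ y) (hyK : (y : ℝ) ≤ L ^ 100000) :
    (y : ℝ) ^ (1 / 4000 : ℝ) ≤ L ^ 25 := by
  have hy0 : (0 : ℝ) ≤ y := by positivity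
  calc (y : ℝ) ^ (1 / 4000 : ℝ) ≤ (L ^ 100000) ^ (1 / 4000 : ℝ) := Real.rpow_le_rpow hy0 hyK (by norm_num)
    _ = L ^ 25 := by
        rw [← Real.rpow_natCast L 100000, ← Real.rpow_mul hL]
        norm_num

/-- The restriction term: `P C (log 2x)³ y^{1/4000} R_b^{−9/20} (2√5·√(2π·3L²)) · L^{48}(L^B)² ≤ 32√5√(6π)PC · L^{−1/6}` for
`R_b ≥ L^{9B+300}/2`. [folklore] -/
theorem minor_term_a (hL3 : 3 ≤ Real.log x) (hx1 : 1 ≤ x) (hy1 : 1 ≤ y) (hyK : (y : ℝ) ≤ Real.log x ^ 100000)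
    (hRb : Real.log x ^ (9 * B + 300) / 2 ≤ Rb) (hP : 1 ≤ P) (hC : 0 ≤ C) :
    Real.log x ^ 48 * (Real.log x ^ B) ^ 2 * (P * (C * Real.log (2 * x) ^ 3 * (y : ℝ) ^ (1 / 4000 : ℝ) *
        Rb ^ (-(9 / 20 : ℝ)) * (2 * Real.sqrt 5 * Real.sqrt (2 * Real.pi * (3 * Real.log x ^ 2))))) ≤
      (32 * Real.sqrt 5 * Real.sqrt (6 * Real.pi) * P * C) * Real.log x ^ (-(1 / 6 : ℝ)) := by
  set L := Real.log x with hL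
  have hL1 : 1 ≤ L := by linarith
  have hL0 : 0 < L := by linarith
  have hx0 : 0 < x := by linarith
  have hl2x : Real.log (2 * x) ≤ 2 * L := log_two_mul_le hx0 hL1
  have hl2x0 : 0 ≤ Real.log (2 * x) := Real.log_nonneg (by linarith)
  have h8 : Real.log (2 * x) ^ 3 ≤ 8 * L ^ 3 := by
    calc Real.log (2 * x) ^ 3 ≤ (2 * L) ^ 3 := pow_le_pow_left₀ hl2x0 hl2x 3
      _ = 8 * L ^ 3 := by ring
  have hy25 : (y : ℝ) ^ (1 / 4000 : ℝ) ≤ L ^ 25 := rpow_y_le hL0.le hy1 hyK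
  -- `R_b^{-9/20} ≤ 2 L^{(9B+300)(-9/20)}`
  have hLp : 0 < L ^ (9 * B + 300) / 2 := by positivity
  have hRb0 : 0 < Rb := lt_of_lt_of_le hLp hRb
  have hRb' : Rb ^ (-(9 / 20 : ℝ)) ≤ 2 * L ^ (((9 * B + 300 : ℕ) : ℝ) * (-(9 / 20 : ℝ))) := by
    calc Rb ^ (-(9 / 20 : ℝ)) ≤ (L ^ (9 * B + 300) / 2) ^ (-(9 / 20 : ℝ)) := Real.rpow_le_rpow_of_nonpos hLp hRb (by norm_num)
      _ = (L ^ (9 * B + 300)) ^ (-(9 / 20 : ℝ)) * (2 : ℝ) ^ (9 / 20 : ℝ) := by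
          rw [Real.div_rpow (by positivity) zero_le_two, Real.rpow_neg zero_le_two, div_eq_mul_inv, inv_inv]
      _ ≤ (L ^ (9 * B + 300)) ^ (-(9 / 20 : ℝ)) * 2 := by
          refine mul_le_mul_of_nonneg_left ?_ (Real.rpow_nonneg (by positivity) _)
          calc (2 : ℝ) ^ (9 / 20 : ℝ) ≤ (2 : ℝ) ^ (1 : ℝ) := Real.rpow_le_rpow_of_exponent_le one_le_two (by norm_num)
            _ = 2 := Real.rpow_one 2
      _ = 2 * L ^ (((9 * B + 300 : ℕ) : ℝ) * (-(9 / 20 : ℝ))) := by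
          rw [← Real.rpow_natCast L (9 * B + 300), ← Real.rpow_mul hL0.le]; ring
  -- the `L`-powers: `L^{48} L^{2B} L^3 L^{25} L · L^{(9B+300)(-9/20)} ≤ L^{-1/6}`
  have hsq : Real.sqrt (2 * Real.pi * (3 * L ^ 2)) = Real.sqrt (6 * Real.pi) * L := sqrt_two_pi_three_sq hL0.le
  have hpow : L ^ 48 * (L ^ B) ^ 2 * L ^ 3 * L ^ 25 * L * L ^ (((9 * B + 300 : ℕ) : ℝ) * (-(9 / 20 : ℝ))) ≤
      L ^ (-(1 / 6 : ℝ)) := by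
    have h1 : L ^ 48 * (L ^ B) ^ 2 * L ^ 3 * L ^ 25 * L = L ^ (((77 + 2 * B : ℕ) : ℝ)) := by
      rw [Real.rpow_natCast]; ring
    rw [h1, ← Real.rpow_add hL0]
    refine Real.rpow_le_rpow_of_exponent_le hL1 ?_
    push_cast
    nlinarith
  set S6 := Real.sqrt (6 * Real.pi) with hS6
  have hS60 : 0 < S6 := Real.sqrt_pos.2 (by positivity)
  have hS5 : 0 < Real.sqrt 5 := Real.sqrt_pos.2 (by norm_num)
  rw [hsq]
  calc _ = (2 * Real.sqrt 5 * S6 * P * C) * ((L ^ 48 * (L ^ B) ^ 2) * Real.log (2 * x) ^ 3 * (y : ℝ) ^ (1 / 4000 : ℝ) *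
        Rb ^ (-(9 / 20 : ℝ)) * L) := by ring
    _ ≤ (2 * Real.sqrt 5 * S6 * P * C) * ((L ^ 48 * (L ^ B) ^ 2) * (8 * L ^ 3) * L ^ 25 *
        (2 * L ^ (((9 * B + 300 : ℕ) : ℝ) * (-(9 / 20 : ℝ)))) * L) := by
        refine mul_le_mul_of_nonneg_left ?_ (by positivity)
        refine mul_le_mul_of_nonneg_right (mul_le_mul (mul_le_mul (mul_le_mul_of_nonneg_left h8 (by positivity))
          hy25 (by positivity) (by positivity)) hRb' (by positivity) (by positivity)) hL0.le
    _ = (32 * Real.sqrt 5 * S6 * P * C) *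
        (L ^ 48 * (L ^ B) ^ 2 * L ^ 3 * L ^ 25 * L * L ^ (((9 * B + 300 : ℕ) : ℝ) * (-(9 / 20 : ℝ)))) := by ring
    _ ≤ _ := mul_le_mul_of_nonneg_left hpow (by positivity)

/-- The trivial-majorant terms: `P(164(1 + log 2x)²y²(2x)^{9/10} + 1)e_B/G₀ · L^{48}(L^B)² ≤ 2953√(6π)P L^{N'} x^{−1/20}`
(`G₀ = x^{1−10⁻⁴}/(√(6π)L)`, `N' ≥ 200051 + 3B`). [folklore] -/
theorem minor_term_b (hL3 : 3 ≤ Real.log x) (hx1 : 1 ≤ x) (hyK : (y : ℝ) ≤ Real.log x ^ 100000) (hP : 1 ≤ P)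
    {N' : ℕ} (hN' : 200051 + 3 * B ≤ N') :
    Real.log x ^ 48 * (Real.log x ^ B) ^ 2 * (P * ((164 * (1 + Real.log (2 * x)) ^ 2 * (y : ℝ) ^ 2 *
        (2 * x) ^ (9 / 10 : ℝ) + 1) * Real.log x ^ B / (x ^ (1 - 1 / 10000 : ℝ) / (Real.sqrt (6 * Real.pi) * Real.log x)))) ≤
      (2953 * Real.sqrt (6 * Real.pi) * P) * (Real.log x ^ N' * x ^ (-(1 / 20 : ℝ))) := by
  set L := Real.log x with hL
  have hL1 : 1 ≤ L := by linarith
  have hL0 : 0 < L := by linarith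
  have hx0 : 0 < x := by linarith
  set S6 := Real.sqrt (6 * Real.pi) with hS6
  have hS60 : 0 < S6 := Real.sqrt_pos.2 (by positivity)
  have hy0 : (0 : ℝ) ≤ y := by positivity
  have hl2x : Real.log (2 * x) ≤ 2 * L := log_two_mul_le hx0 hL1
  have hl2x0 : 0 ≤ Real.log (2 * x) := Real.log_nonneg (by linarith)
  -- the bracket `≤ 2953 L^{200002} x^{9/10}`
  have hbr : 164 * (1 + Real.log (2 * x)) ^ 2 * (y : ℝ) ^ 2 * (2 * x) ^ (9 / 10 : ℝ) + 1 ≤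
      2953 * (L ^ 200002 * x ^ (9 / 10 : ℝ)) := by
    have h1 : (1 + Real.log (2 * x)) ^ 2 ≤ 9 * L ^ 2 := by
      calc (1 + Real.log (2 * x)) ^ 2 ≤ (3 * L) ^ 2 := pow_le_pow_left₀ (by positivity) (by linarith) 2
        _ = 9 * L ^ 2 := by ring
    have h2 : (y : ℝ) ^ 2 ≤ L ^ 200000 := by
      calc (y : ℝ) ^ 2 ≤ (L ^ 100000) ^ 2 := pow_le_pow_left₀ hy0 hyK 2
        _ = L ^ 200000 := by ring
    have h3 : (2 * x) ^ (9 / 10 : ℝ) ≤ 2 * x ^ (9 / 10 : ℝ) := by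
      rw [Real.mul_rpow zero_le_two hx0.le]
      refine mul_le_mul_of_nonneg_right ?_ (Real.rpow_nonneg hx0.le _)
      calc (2 : ℝ) ^ (9 / 10 : ℝ) ≤ (2 : ℝ) ^ (1 : ℝ) := Real.rpow_le_rpow_of_exponent_le one_le_two (by norm_num)
        _ = 2 := Real.rpow_one 2
    have h4 : (1 : ℝ) ≤ L ^ 200002 * x ^ (9 / 10 : ℝ) := one_le_mul_of_one_le_of_one_le (one_le_pow₀ hL1) (Real.one_le_rpow hx1 (by norm_num))
    have hmain : 164 * (1 + Real.log (2 * x)) ^ 2 * (y : ℝ) ^ 2 * (2 * x) ^ (9 / 10 : ℝ) ≤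
        164 * (9 * L ^ 2) * L ^ 200000 * (2 * x ^ (9 / 10 : ℝ)) :=
      mul_le_mul (mul_le_mul (mul_le_mul_of_nonneg_left h1 (by norm_num)) h2 (by positivity) (by positivity)) h3
        (by positivity) (by positivity)
    have : 164 * (9 * L ^ 2) * L ^ 200000 * (2 * x ^ (9 / 10 : ℝ)) = 2952 * (L ^ 200002 * x ^ (9 / 10 : ℝ)) := by ring
    linarith
  have hxpow : x ^ (9 / 10 : ℝ) / x ^ (1 - 1 / 10000 : ℝ) ≤ x ^ (-(1 / 20 : ℝ)) := by
    rw [← Real.rpow_sub hx0]; exact Real.rpow_le_rpow_of_exponent_le hx1 (by norm_num)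
  have hLN : L ^ 48 * (L ^ B) ^ 2 * L ^ 200002 * L ^ B * L ≤ L ^ N' := by
    have : L ^ 48 * (L ^ B) ^ 2 * L ^ 200002 * L ^ B * L = L ^ (200051 + 3 * B) := by ring
    rw [this]; exact pow_le_pow_right₀ hL1 hN'
  calc _ = (S6 * P) * ((L ^ 48 * (L ^ B) ^ 2) * (164 * (1 + Real.log (2 * x)) ^ 2 * (y : ℝ) ^ 2 * (2 * x) ^ (9 / 10 : ℝ) + 1) *
        L ^ B * L) / x ^ (1 - 1 / 10000 : ℝ) := by
        field_simp
    _ ≤ (S6 * P) * ((L ^ 48 * (L ^ B) ^ 2) * (2953 * (L ^ 200002 * x ^ (9 / 10 : ℝ))) * L ^ B * L) / x ^ (1 - 1 / 10000 : ℝ) := by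
        gcongr
    _ = (2953 * S6 * P) * (L ^ 48 * (L ^ B) ^ 2 * L ^ 200002 * L ^ B * L) * (x ^ (9 / 10 : ℝ) / x ^ (1 - 1 / 10000 : ℝ)) := by
        ring
    _ ≤ (2953 * S6 * P) * L ^ N' * x ^ (-(1 / 20 : ℝ)) :=
        mul_le_mul (mul_le_mul_of_nonneg_left hLN (by positivity)) hxpow (by positivity) (by positivity)
    _ = _ := by ring

/-- The transfer terms: `(P·64√(2π·3L²)/R_b² + 8√(2π·3L²)P/R_b³) · L^{48}(L^B)² ≤ 320√(6π)P · L^{−1/6}` for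
`R_b ≥ L^{9B+300}/2`. [folklore] -/
theorem minor_term_cd (hL3 : 3 ≤ Real.log x) (hRb : Real.log x ^ (9 * B + 300) / 2 ≤ Rb) (hP : 1 ≤ P) :
    Real.log x ^ 48 * (Real.log x ^ B) ^ 2 * (P * (64 * Real.sqrt (2 * Real.pi * (3 * Real.log x ^ 2)) / Rb ^ 2) +
        8 * Real.sqrt (2 * Real.pi * (3 * Real.log x ^ 2)) * P / Rb ^ 3) ≤
      (320 * Real.sqrt (6 * Real.pi) * P) * Real.log x ^ (-(1 / 6 : ℝ)) := by
  set L := Real.log x with hL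
  have hL1 : 1 ≤ L := by linarith
  have hL0 : 0 < L := by linarith
  set S6 := Real.sqrt (6 * Real.pi) with hS6
  have hS60 : 0 < S6 := Real.sqrt_pos.2 (by positivity)
  rw [sqrt_two_pi_three_sq hL0.le]
  set T : ℝ := L ^ (9 * B + 300) with hT
  have hT0 : 0 < T := by positivity
  have hRb0 : 0 < Rb := lt_of_lt_of_le (by positivity) hRb
  have hRb2 : 1 / Rb ^ 2 ≤ 4 / T ^ 2 := by
    rw [div_le_div_iff₀ (by positivity) (by positivity), one_mul]
    nlinarith [mul_pos hT0 hRb0]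
  have hRb3 : 1 / Rb ^ 3 ≤ 8 / T ^ 3 := by
    rw [div_le_div_iff₀ (by positivity) (by positivity), one_mul]
    have h := pow_le_pow_left₀ (by positivity : 0 ≤ T / 2) (by linarith : T / 2 ≤ Rb) 3
    have : (T / 2) ^ 3 = T ^ 3 / 8 := by ring
    rw [this] at h
    linarith
  -- `L^{49+2B}/T^2 ≤ 1/L` and `L^{49+2B}/T^3 ≤ 1/L`
  have hLT2 : L ^ 48 * (L ^ B) ^ 2 * L * (4 / T ^ 2) ≤ 4 * L ^ (-(1 / 6 : ℝ)) := by
    have h1 : L ^ 48 * (L ^ B) ^ 2 * L * (4 / T ^ 2) = 4 * (1 / L ^ (16 * B + 551)) := by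
      rw [hT]; field_simp; ring
    rw [h1]
    exact mul_le_mul_of_nonneg_left (inv_pow_le_rpow_neg_sixth hL1 (by omega)) (by norm_num)
  have hLT3 : L ^ 48 * (L ^ B) ^ 2 * L * (8 / T ^ 3) ≤ 8 * L ^ (-(1 / 6 : ℝ)) := by
    have h1 : L ^ 48 * (L ^ B) ^ 2 * L * (8 / T ^ 3) = 8 * (1 / L ^ (25 * B + 851)) := by
      rw [hT]; field_simp; ring
    rw [h1]
    exact mul_le_mul_of_nonneg_left (inv_pow_le_rpow_neg_sixth hL1 (by omega)) (by norm_num)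
  calc _ = 64 * S6 * P * (L ^ 48 * (L ^ B) ^ 2 * L * (1 / Rb ^ 2)) + 8 * S6 * P * (L ^ 48 * (L ^ B) ^ 2 * L * (1 / Rb ^ 3)) := by
        ring
    _ ≤ 64 * S6 * P * (L ^ 48 * (L ^ B) ^ 2 * L * (4 / T ^ 2)) + 8 * S6 * P * (L ^ 48 * (L ^ B) ^ 2 * L * (8 / T ^ 3)) := by
        gcongr
    _ ≤ 64 * S6 * P * (4 * L ^ (-(1 / 6 : ℝ))) + 8 * S6 * P * (8 * L ^ (-(1 / 6 : ℝ))) :=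
        add_le_add (mul_le_mul_of_nonneg_left hLT2 (by positivity)) (mul_le_mul_of_nonneg_left hLT3 (by positivity))
    _ = _ := by ring

end Minor

/-! ### Packaging: one constant, one gauge -/

section Pack

/-- **Decay of the flat major-arc error.**  For the parameter choice of `SmoothParityAsymptotic` (module docstring) there is
`A ≥ 0` with `F ≤ A·g`, `Δ ≤ A·g`, `W ≤ A·g`, `η ≤ A·g`, `g = (log L)²/L + L^{−1/6} + L^N x^{−1/20}`, whenever `L = log x ≥ 3`,
`x ≥ 1`, `R ∈ [L^r/2, L^r]`, `L^r ≤ R + 1`, `1 ≤ y ≤ L^{100000}` (`r = 10B + 300`, `N = 23r + 3B + 200051`). [folklore] -/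
theorem major_rate (B : ℕ) {P H D C_F C_W : ℝ} (hP : 1 ≤ P) (hH : 1 ≤ H) (hD : 1 ≤ D) (hCF : 0 ≤ C_F) (hCW : 0 ≤ C_W) :
    ∃ A : ℝ, 0 ≤ A ∧ ∀ (x R : ℝ) (y : ℕ), 3 ≤ Real.log x → 1 ≤ x →
      Real.log x ^ (10 * B + 300) / 2 ≤ R → R ≤ Real.log x ^ (10 * B + 300) → Real.log x ^ (10 * B + 300) ≤ R + 1 →
      1 ≤ y → (y : ℝ) ≤ Real.log x ^ 100000 →
      (P ^ 3 * H * (331 * (C_W * (((B + 2 * (10 * B + 300) + 3 : ℕ) : ℝ) + 1) ^ 2 * Real.log (y : ℝ) / Real.log x) *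
            (28 + 16 * Real.log (2 * Real.log x ^ B)) +
          100 * (Real.log x ^ B / (3 * R) + 8 * D * (1 + 2 * Real.log x ^ B * (1 + Real.log (2 * x))) / x)) +
        2316 * R * (3 * (11 * P + 1) ^ 2 * (12 * (1 + R ^ 4) * P * Real.log x ^ B / x + 16 * P / (R ^ 4) ^ 3) * H +
          375 * (11 * P + 2) ^ 2 * (2 * R * C_F * x ^ (1 / 2 + 1 / 100 : ℝ) * (2 * R) ^ (1 / 100 : ℝ) * (1 + R ^ 4) ^ 3 * P * Real.log x ^ B /
            (x ^ (1 - 1 / 10000 : ℝ) / (Real.sqrt (6 * Real.pi) * Real.log x)) +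
          16 * Real.sqrt (2 * Real.pi * (3 * Real.log x ^ 2)) * P / (R ^ 4) ^ 3) * R ^ 8) +
        48 * D ^ 2 * P ^ 3 * (R + 1) ^ (-(1 / 6 : ℝ))) ≤
        A * (Real.log (Real.log x) ^ 2 / Real.log x + Real.log x ^ (-(1 / 6 : ℝ)) +
          Real.log x ^ (23 * (10 * B + 300) + 3 * B + 200051) * x ^ (-(1 / 20 : ℝ))) ∧
      (12 * (1 + R ^ 4) * P * Real.log x ^ B / x + 16 * P / (R ^ 4) ^ 3) ≤
        A * (Real.log (Real.log x) ^ 2 / Real.log x + Real.log x ^ (-(1 / 6 : ℝ)) +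
          Real.log x ^ (23 * (10 * B + 300) + 3 * B + 200051) * x ^ (-(1 / 20 : ℝ))) ∧
      (2 * R * C_F * x ^ (1 / 2 + 1 / 100 : ℝ) * (2 * R) ^ (1 / 100 : ℝ) * (1 + R ^ 4) ^ 3 * P * Real.log x ^ B /
            (x ^ (1 - 1 / 10000 : ℝ) / (Real.sqrt (6 * Real.pi) * Real.log x)) +
          16 * Real.sqrt (2 * Real.pi * (3 * Real.log x ^ 2)) * P / (R ^ 4) ^ 3) ≤
        A * (Real.log (Real.log x) ^ 2 / Real.log x + Real.log x ^ (-(1 / 6 : ℝ)) +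
          Real.log x ^ (23 * (10 * B + 300) + 3 * B + 200051) * x ^ (-(1 / 20 : ℝ))) ∧
      (C_W * (((B + 2 * (10 * B + 300) + 3 : ℕ) : ℝ) + 1) ^ 2 * Real.log (y : ℝ) / Real.log x) ≤
        A * (Real.log (Real.log x) ^ 2 / Real.log x + Real.log x ^ (-(1 / 6 : ℝ)) +
          Real.log x ^ (23 * (10 * B + 300) + 3 * B + 200051) * x ^ (-(1 / 20 : ℝ))) := by
  set S6 := Real.sqrt (6 * Real.pi) with hS6
  have hS60 : 0 < S6 := Real.sqrt_pos.2 (by positivity)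
  set B' : ℕ := B + 2 * (10 * B + 300) + 3 with hB'
  set A₁ : ℝ := 331 * P ^ 3 * H * C_W * ((B' : ℝ) + 1) ^ 2 * 100000 * (44 + 16 * B) with hA₁
  set Aη : ℝ := C_W * ((B' : ℝ) + 1) ^ 2 * 100000 with hAη
  set A₂ : ℝ := 5600 * P ^ 3 * H * D with hA₂
  set A₃ : ℝ := 6948 * (11 * P + 1) ^ 2 * H * (32 * P) with hA₃
  set A₄ : ℝ := 868500 * (11 * P + 2) ^ 2 * (32 * S6 * (C_F + 1) * P) with hA₄
  set A₅ : ℝ := 48 * D ^ 2 * P ^ 3 with hA₅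
  have h0 : 0 ≤ A₁ ∧ 0 ≤ Aη ∧ 0 ≤ A₂ ∧ 0 ≤ A₃ ∧ 0 ≤ A₄ ∧ 0 ≤ A₅ :=
    ⟨by positivity, by positivity, by positivity, by positivity, by positivity, by positivity⟩
  refine ⟨A₁ + Aη + A₂ + A₃ + A₄ + A₅, by linarith [h0.1, h0.2.1, h0.2.2.1, h0.2.2.2.1, h0.2.2.2.2.1, h0.2.2.2.2.2], ?_⟩
  intro x R y hL3 hx1 hRlo hRhi hRfl hy1 hyK
  set L := Real.log x with hL
  have hL1 : 1 ≤ L := by linarith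
  have hL0 : 0 < L := by linarith
  have hLr : L ≤ L ^ (10 * B + 300) := by simpa using pow_le_pow_right₀ hL1 (show 1 ≤ 10 * B + 300 by omega)
  have hR1 : 1 ≤ R := by linarith
  have hR0 : 0 < R := by linarith
  -- the gauge
  have hx0 : 0 ≤ x := by linarith
  have hg₁0 : 0 ≤ Real.log L ^ 2 / L := by positivity
  have hg2 : 0 ≤ L ^ (-(1 / 6 : ℝ)) := Real.rpow_nonneg hL0.le _
  have hg3 : 0 ≤ L ^ (23 * (10 * B + 300) + 3 * B + 200051) * x ^ (-(1 / 20 : ℝ)) := by positivity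
  set G : ℝ := Real.log L ^ 2 / L + L ^ (-(1 / 6 : ℝ)) + L ^ (23 * (10 * B + 300) + 3 * B + 200051) * x ^ (-(1 / 20 : ℝ))
    with hGdef
  have hG1 : Real.log L ^ 2 / L ≤ G := by rw [hGdef]; linarith
  have hG2 : L ^ (-(1 / 6 : ℝ)) ≤ G := by rw [hGdef]; linarith
  have hG' : L ^ (-(1 / 6 : ℝ)) + L ^ (23 * (10 * B + 300) + 3 * B + 200051) * x ^ (-(1 / 20 : ℝ)) ≤ G := by rw [hGdef]; linarith
  have hG0 : 0 ≤ G := by rw [hGdef]; positivity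
  -- the five terms
  obtain ⟨e1, e1'⟩ := major_term_eta (B := B) hL3 hy1 hyK hP hH hCW B'
  have e2 := major_term_off (B := B) (N := 23 * (10 * B + 300) + 3 * B + 200051) hL3 hx1 (r := 10 * B + 300)
    (by omega) (by omega) hRlo hP hH hD
  have e3 := major_term_delta (B := B) (N := 23 * (10 * B + 300) + 3 * B + 200051) hL3 hx1 (r := 10 * B + 300)
    (by omega) (by omega) hRlo hRhi hR1 hP
  have e4 := major_term_W (B := B) (N := 23 * (10 * B + 300) + 3 * B + 200051) hL3 hx1 (r := 10 * B + 300)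
    (by omega) (by omega) hRlo hRhi hR1 hP hCF
  have e5 := major_term_tail (P := P) (D := D) hL3 (r := 10 * B + 300) (by omega) hRfl hP hD
  rw [← hL] at e1 e1' e2 e3 e4 e5
  obtain ⟨h01, h0η, h02, h03, h04, h05⟩ := h0
  -- names for the two relative flat errors and `η`
  set Δe : ℝ := 12 * (1 + R ^ 4) * P * L ^ B / x + 16 * P / (R ^ 4) ^ 3 with hΔe
  set We : ℝ := 2 * R * C_F * x ^ (1 / 2 + 1 / 100 : ℝ) * (2 * R) ^ (1 / 100 : ℝ) * (1 + R ^ 4) ^ 3 * P * L ^ B /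
      (x ^ (1 - 1 / 10000 : ℝ) / (S6 * L)) + 16 * Real.sqrt (2 * Real.pi * (3 * L ^ 2)) * P / (R ^ 4) ^ 3 with hWe
  set ηe : ℝ := C_W * ((B' : ℝ) + 1) ^ 2 * Real.log (y : ℝ) / L with hηe
  have hΔ0 : 0 ≤ Δe := by rw [hΔe]; positivity
  have hW0 : 0 ≤ We := by rw [hWe]; positivity
  have hΔR : Δe ≤ R * Δe := le_mul_of_one_le_left hΔ0 hR1
  have hWR : We ≤ R ^ 9 * We := le_mul_of_one_le_left hW0 (one_le_pow₀ hR1)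
  -- each term against `G`
  have t1 : P ^ 3 * H * (331 * ηe * (28 + 16 * Real.log (2 * L ^ B))) ≤ A₁ * G :=
    e1.trans (mul_le_mul_of_nonneg_left hG1 h01)
  have t2 : P ^ 3 * H * (100 * (L ^ B / (3 * R) + 8 * D * (1 + 2 * L ^ B * (1 + Real.log (2 * x))) / x)) ≤ A₂ * G :=
    e2.trans (mul_le_mul_of_nonneg_left hG' h02)
  have t3 : 6948 * (11 * P + 1) ^ 2 * H * (R * Δe) ≤ A₃ * G := by
    calc 6948 * (11 * P + 1) ^ 2 * H * (R * Δe) ≤ 6948 * (11 * P + 1) ^ 2 * H * ((32 * P) * G) :=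
          mul_le_mul_of_nonneg_left (e3.trans (mul_le_mul_of_nonneg_left hG' (by positivity))) (by positivity)
      _ = A₃ * G := by rw [hA₃]; ring
  have t4 : 868500 * (11 * P + 2) ^ 2 * (R ^ 9 * We) ≤ A₄ * G := by
    calc 868500 * (11 * P + 2) ^ 2 * (R ^ 9 * We) ≤ 868500 * (11 * P + 2) ^ 2 * ((32 * S6 * (C_F + 1) * P) * G) :=
          mul_le_mul_of_nonneg_left (e4.trans (mul_le_mul_of_nonneg_left hG' (by positivity))) (by positivity)
      _ = A₄ * G := by rw [hA₄]; ring
  have t5 : 48 * D ^ 2 * P ^ 3 * (R + 1) ^ (-(1 / 6 : ℝ)) ≤ A₅ * G := e5.trans (mul_le_mul_of_nonneg_left hG2 h05)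
  have hAG : 0 ≤ Aη * G := mul_nonneg h0η hG0
  refine ⟨?_, ?_, ?_, ?_⟩
  · have hF : P ^ 3 * H * (331 * ηe * (28 + 16 * Real.log (2 * L ^ B)) +
          100 * (L ^ B / (3 * R) + 8 * D * (1 + 2 * L ^ B * (1 + Real.log (2 * x))) / x)) +
        2316 * R * (3 * (11 * P + 1) ^ 2 * Δe * H + 375 * (11 * P + 2) ^ 2 * We * R ^ 8) +
        48 * D ^ 2 * P ^ 3 * (R + 1) ^ (-(1 / 6 : ℝ)) =
        P ^ 3 * H * (331 * ηe * (28 + 16 * Real.log (2 * L ^ B))) +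
        P ^ 3 * H * (100 * (L ^ B / (3 * R) + 8 * D * (1 + 2 * L ^ B * (1 + Real.log (2 * x))) / x)) +
        6948 * (11 * P + 1) ^ 2 * H * (R * Δe) + 868500 * (11 * P + 2) ^ 2 * (R ^ 9 * We) +
        48 * D ^ 2 * P ^ 3 * (R + 1) ^ (-(1 / 6 : ℝ)) := by ring
    rw [hF]
    have := add_le_add (add_le_add (add_le_add (add_le_add t1 t2) t3) t4) t5
    linarith
  · have hA2ge : 32 * P ≤ A₂ := by
      rw [hA₂]
      have hP3 : P ≤ P ^ 3 := by
        calc P = P * 1 * 1 := by ring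
          _ ≤ P * P * P := by gcongr
          _ = P ^ 3 := by ring
      calc 32 * P ≤ 5600 * P ^ 3 := by linarith
        _ = 5600 * P ^ 3 * 1 * 1 := by ring
        _ ≤ 5600 * P ^ 3 * H * D := by gcongr
    calc Δe ≤ R * Δe := hΔR
      _ ≤ 32 * P * G := e3.trans (mul_le_mul_of_nonneg_left hG' (by positivity))
      _ ≤ A₂ * G := mul_le_mul_of_nonneg_right hA2ge hG0
      _ ≤ _ := mul_le_mul_of_nonneg_right (by linarith) hG0
  · have hX0 : 0 ≤ 32 * S6 * (C_F + 1) * P := by positivity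
    have h169 : (1 : ℝ) ≤ 868500 * (11 * P + 2) ^ 2 :=
      one_le_mul_of_one_le_of_one_le (by norm_num) (one_le_pow₀ (by linarith))
    have hA4ge : 32 * S6 * (C_F + 1) * P ≤ A₄ := by rw [hA₄]; exact le_mul_of_one_le_left hX0 h169
    calc We ≤ R ^ 9 * We := hWR
      _ ≤ 32 * S6 * (C_F + 1) * P * G := e4.trans (mul_le_mul_of_nonneg_left hG' hX0)
      _ ≤ A₄ * G := mul_le_mul_of_nonneg_right hA4ge hG0
      _ ≤ _ := mul_le_mul_of_nonneg_right (by linarith) hG0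
  · calc ηe ≤ Aη * (Real.log L ^ 2 / L) := e1'
      _ ≤ Aη * G := mul_le_mul_of_nonneg_left hG1 h0η
      _ ≤ _ := mul_le_mul_of_nonneg_right (by linarith) hG0

/-- **Decay of the flat minor-arc error.**  For the parameter choice of `SmoothParityAsymptotic` there is `A ≥ 0` with
`L^{48} e_B² s ≤ A·g` whenever `L = log x ≥ 3`, `x ≥ 1`, `R_b ≥ L^{9B+300}/2`, `1 ≤ y ≤ L^{100000}`. [folklore] -/
theorem minor_rate (B : ℕ) {P C : ℝ} (hP : 1 ≤ P) (hC : 0 ≤ C) :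
    ∃ A : ℝ, 0 ≤ A ∧ ∀ (x Rb : ℝ) (y : ℕ), 3 ≤ Real.log x → 1 ≤ x → Real.log x ^ (9 * B + 300) / 2 ≤ Rb →
      1 ≤ y → (y : ℝ) ≤ Real.log x ^ 100000 →
      Real.log x ^ 48 * (Real.log x ^ B) ^ 2 *
        (P * (C * Real.log (2 * x) ^ 3 * (y : ℝ) ^ (1 / 4000 : ℝ) * Rb ^ (-(9 / 20 : ℝ)) *
            (2 * Real.sqrt 5 * Real.sqrt (2 * Real.pi * (3 * Real.log x ^ 2))) +
          (164 * (1 + Real.log (2 * x)) ^ 2 * (y : ℝ) ^ 2 * (2 * x) ^ (9 / 10 : ℝ) + 1) * Real.log x ^ B /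
            (x ^ (1 - 1 / 10000 : ℝ) / (Real.sqrt (6 * Real.pi) * Real.log x)) +
          64 * Real.sqrt (2 * Real.pi * (3 * Real.log x ^ 2)) / Rb ^ 2) +
        8 * Real.sqrt (2 * Real.pi * (3 * Real.log x ^ 2)) * P / Rb ^ 3) ≤
        A * (Real.log (Real.log x) ^ 2 / Real.log x + Real.log x ^ (-(1 / 6 : ℝ)) +
          Real.log x ^ (23 * (10 * B + 300) + 3 * B + 200051) * x ^ (-(1 / 20 : ℝ))) := by
  set S6 := Real.sqrt (6 * Real.pi) with hS6
  have hS60 : 0 < S6 := Real.sqrt_pos.2 (by positivity)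
  set Aa : ℝ := 32 * Real.sqrt 5 * S6 * P * C with hAa
  set Ab : ℝ := 2953 * S6 * P with hAb
  set Ac : ℝ := 320 * S6 * P with hAc
  have h0 : 0 ≤ Aa ∧ 0 ≤ Ab ∧ 0 ≤ Ac := ⟨by positivity, by positivity, by positivity⟩
  refine ⟨Aa + Ab + Ac, by linarith [h0.1, h0.2.1, h0.2.2], ?_⟩
  intro x Rb y hL3 hx1 hRb hy1 hyK
  have ea := minor_term_a (B := B) hL3 hx1 hy1 hyK hRb hP hC
  have eb := minor_term_b (B := B) (N' := 23 * (10 * B + 300) + 3 * B + 200051) hL3 hx1 hyK hP (by omega)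
  have ec := minor_term_cd (B := B) hL3 hRb hP
  set L := Real.log x with hL
  have hL0 : 0 < L := by linarith
  have hx0 : 0 ≤ x := by linarith
  have hg₁0 : 0 ≤ Real.log L ^ 2 / L := by positivity
  have hg2 : 0 ≤ L ^ (-(1 / 6 : ℝ)) := Real.rpow_nonneg hL0.le _
  have hg3 : 0 ≤ L ^ (23 * (10 * B + 300) + 3 * B + 200051) * x ^ (-(1 / 20 : ℝ)) := by positivity
  set G : ℝ := Real.log L ^ 2 / L + L ^ (-(1 / 6 : ℝ)) + L ^ (23 * (10 * B + 300) + 3 * B + 200051) * x ^ (-(1 / 20 : ℝ))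
    with hGdef
  have hG2 : L ^ (-(1 / 6 : ℝ)) ≤ G := by rw [hGdef]; linarith
  have hG3 : L ^ (23 * (10 * B + 300) + 3 * B + 200051) * x ^ (-(1 / 20 : ℝ)) ≤ G := by rw [hGdef]; linarith
  have hG0 : 0 ≤ G := by rw [hGdef]; positivity
  obtain ⟨h0a, h0b, h0c⟩ := h0
  have ta := ea.trans (mul_le_mul_of_nonneg_left hG2 h0a)
  have tb := eb.trans (mul_le_mul_of_nonneg_left hG3 h0b)
  have tc := ec.trans (mul_le_mul_of_nonneg_left hG2 h0c)
  have hsplit : L ^ 48 * (L ^ B) ^ 2 *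
      (P * (C * Real.log (2 * x) ^ 3 * (y : ℝ) ^ (1 / 4000 : ℝ) * Rb ^ (-(9 / 20 : ℝ)) *
            (2 * Real.sqrt 5 * Real.sqrt (2 * Real.pi * (3 * L ^ 2))) +
          (164 * (1 + Real.log (2 * x)) ^ 2 * (y : ℝ) ^ 2 * (2 * x) ^ (9 / 10 : ℝ) + 1) * L ^ B /
            (x ^ (1 - 1 / 10000 : ℝ) / (Real.sqrt (6 * Real.pi) * L)) +
          64 * Real.sqrt (2 * Real.pi * (3 * L ^ 2)) / Rb ^ 2) +
        8 * Real.sqrt (2 * Real.pi * (3 * L ^ 2)) * P / Rb ^ 3) =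
      L ^ 48 * (L ^ B) ^ 2 * (P * (C * Real.log (2 * x) ^ 3 * (y : ℝ) ^ (1 / 4000 : ℝ) * Rb ^ (-(9 / 20 : ℝ)) *
        (2 * Real.sqrt 5 * Real.sqrt (2 * Real.pi * (3 * L ^ 2))))) +
      L ^ 48 * (L ^ B) ^ 2 * (P * ((164 * (1 + Real.log (2 * x)) ^ 2 * (y : ℝ) ^ 2 * (2 * x) ^ (9 / 10 : ℝ) + 1) * L ^ B /
        (x ^ (1 - 1 / 10000 : ℝ) / (S6 * L)))) +
      L ^ 48 * (L ^ B) ^ 2 * (P * (64 * Real.sqrt (2 * Real.pi * (3 * L ^ 2)) / Rb ^ 2) +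
        8 * Real.sqrt (2 * Real.pi * (3 * L ^ 2)) * P / Rb ^ 3) := by ring
  rw [hsplit]
  have := add_le_add (add_le_add ta tb) tc
  linarith


end Pack

end SmoothArcs

end Literature.NumberTheory.Sieve

end
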